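import Literature.AnabelianGeometry.AbsoluteAnabelian.AbsTopIII.ReconstructionThm19Functorial
import HarnessLib

/-!
# [AbsTopIII] Theorem 1.9 WITH its functoriality clause, second instalment: equivariance under RECORDED GEOMETRIC
# AUTOMORPHISMS of `Π_X ↠ G_k` (not only inner ones) — the named fact `Thm_1_9aut'` ⊇ `Thm_1_9'`

S. Mochizuki, *Topics in Absolute Anabelian Geometry III*, J. Math. Sci. Univ. Tokyo **22** (2015) 939–1156
[cite: MochizukiAbsTopIII2015, Thm 1.9 pp.37-38] (manuscript pagination as in `Reconstruction.lean`; journal pp. 986–988):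
«there exists a functorial "group-theoretic" algorithm … for reconstructing the "NF-portion of the function field" of `X` from the
extension of profinite groups `1 → Δ_X → Π_X → G_k → 1`» (p. 37); «the asserted "functoriality" is with respect to arbitrary open
injective homomorphisms of extensions of profinite groups … as well as … base-change» (p. 38); Rmk. 1.9.5 (i) p. 39 («the functoriality
with respect to isomorphisms … may be regarded as yielding a new proof of the "profinite absolute version of the Grothendieck Conjecture
over number fields"»); Rmk. 1.9.8 pp. 40–41 («"group-theoretic algorithm" … corresponds … to the functoriality — e.g., with respect to
isomorphisms of some type — of the algorithm»).

## Why this file exists (abc-iut cell; ERRATA-L5 X-143, L4 owner's follow-up named in the GB-16 design memo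
## `pub/ideators/abc-iut-inv-2/X143-CURE-DESIGN.md` v0.3 sha16 abfa469e185ddc38 §(vi) bullet 7 and in the L4 co-sign of 2026-08-28T23:12Z:
## «the open-injection / non-inner-isomorphism parts of print's functoriality — a later DATUM design»)

`Thm_1_9' M ρ` (`ReconstructionThm19Functorial.lean`, GB-17) transcribes print's functoriality in its INNER-isomorphism instance: the
(e)-comparison intertwines `A.map (innerIso g)` with the model's recorded action of `g ∈ Π_X` — which at the curves of interest is the
COEFFICIENT action through `Π_X ↠ G_k ≅ Gal(k̄/k)`.  Its teeth are therefore on the CONSTANT side (a witness must realise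
`Inn(Π_X) → Gal(k̄/k) → Aut(K_{Z,NF})` functorially — Neukirch–Uchida-type content); the TRANSCENDENTAL part of `K_{Z,NF}` is untouched by
inner elements and stays comparison-only (L4 scope note of record).  Print's functoriality is «with respect to isomorphisms» of extensions
in general — in particular the GEOMETRIC OUTER automorphisms of `Π_X ↠ G_k` induced by automorphisms / deck transformations of the curve
(e.g. conjugation by `Π_C` on `Π_X ⊲ Π_C` for the double cover `X → C = X/{±1}` of [IUTchI] §1), whose action on `K_{X,NF}` MOVES
transcendental elements (the elliptic involution `y ↦ −y`).  THIS FILE types that instance, by the same device as GB-17 (a MODEL-SIDE DATUM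
saying which automorphisms of the extension are geometric and how they act — `CurveModel` has no morphisms between curves to derive it):

* `CurveModel.NFGaloisAutAction M` EXTENDS `NFGaloisAction` by `geomAut i : Set ((M.ext (curve i) ≅ M.ext (curve i)) × (K ≃+* K))` —
  the model's record «the automorphism `α` of `Π_X ↠ G_k` is geometric and acts on `K_{X,NF}` by `τ`»;
* `NFPortionAlgorithm.AutEquivariantAt A M ρ i` — ONE comparison `φ` intertwining BOTH the inner transport with `ρ.act` (as in
  `InnerEquivariantAt`) AND `A.map α` with `τ` for every recorded `(α, τ)`;
* `Thm_1_9aut'.WitnessedBy` / **`Thm_1_9aut' M ρ`** and the projections `AutEquivariantAt.innerEquivariantAt`,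
  `Thm_1_9aut'.toThm_1_9'` (⇒ `toThm_1_9`): nothing of the binder of record is lost, `Thm_1_9aut' ⊇ Thm_1_9' ⊇ Thm_1_9`;
* NON-TRANSPARENCY beyond GB-17's (about the WITNESS CLASS, never «¬ Thm_1_9aut' (named model)»): `not_autEquivariantAt_of_map_eq_refl` — an
  algorithm whose transport along a recorded geometric `α` is the identity witnesses `AutEquivariantAt` for NO `φ` once `τ` moves one
  element; and `not_autEquivariantAt_of_map_fixes` — finer: if the recorded `τ` moves an element `t` while the algorithm's `A.map α` FIXES
  `φ⁻¹ t` … stated as: if `A.map α` fixes every element of some set `S ⊆ K_A` with `φ '' S ∋ t` and `τ t ≠ t`, then `φ` is not a witness —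
  packaged as `not_autEquivariantAt_of_forall_map_mem_fixed` (the «coefficient-only transport» costume: an algorithm that moves only what
  the coefficient action moves cannot witness a recorded deck transformation that moves a transcendental).
  At the genuine étale-`π₁` model the Kummer-theoretic algorithm of print IS equivariant for every geometric automorphism (Kummer classes
  are natural), so `Thm_1_9aut'` is again IMPLIED BY print's theorem at the intended model — a weakening of print, never a strengthening.

ADMISSIBILITY: a NAMED FACT relative to `(M, ρ)`, consumed ONLY in instance form at a named pair (none is named in this file; the
abc-iut enriched model records no geometric automorphism of `Π_{X_F}` with its action on `F̄(E)` yet — typing the elliptic involution on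
the function field is the next datum item); `∀ M ρ` is refuted a fortiori by `not_forall_thm_1_9`.  What is STILL not typed: functoriality
along OPEN INJECTIONS that are not isomorphisms (`comap`) and base change (`comapBase`) compared with model-side field embeddings
`K_{X,NF} ↪ K_{Y,NF}` — these constrain a read-off algorithm only together with the automorphism clause (a fixed embedding is
read-off-able), so they are left to the datum item that records covers.

No `instance`, no notation, no axiom, no `sorry`; nothing of [AbsTopIII] is proved or refuted here (a strengthened fact typed by name is
a HYPOTHESIS); nothing here bears on the disputed [IUTchIII] Cor. 3.12 or asserts that abc is proved or refuted; typed ≠ inhabited ≠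
proved-in-print.
-/

noncomputable section

open CategoryTheory
open scoped Pointwise

namespace Literature.AnabelianGeometry.AbsoluteAnabelian.AbsTopIII

universe u

/-! ### The model-side datum with recorded geometric automorphisms, and the equivariance clause -/

/-- **Model-side datum, second instalment**: `NFGaloisAction` (recorded curves with the `Π_U`-action on `K_{Z_NF}`) EXTENDED by, at each
recorded curve, the model's record of GEOMETRIC automorphisms of the extension `Π_U ↠ G_k` with their action on `K_{Z_NF}`: a set of pairs
`(α, τ)` read «`α` is induced by an automorphism / deck transformation of the curve (over an automorphism of `k̄`), acting on `K_{Z_NF}` by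
`τ`».  Inner pairs `(innerIso g, act i g)` may or may not be listed; the clause below treats `act` and `geomAut` together under ONE
comparison.  Laws (closure under composition, `τ` determined by `α`) are the model's business. [cite: MochizukiAbsTopIII2015, Thm 1.9 p.38] -/
structure CurveModel.NFGaloisAutAction (M : CurveModel.{u}) extends CurveModel.NFGaloisAction M where
  /-- the recorded geometric automorphisms of `Π_U ↠ G_k` at the curve `curve i`, each with its action on `K_{Z_NF}` -/
  geomAut : ∀ i, Set ((M.ext (curve i) ≅ M.ext (curve i)) ×
    (M.NFFunctionField (curve i) ≃+* M.NFFunctionField (curve i)))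

/-- **Equivariance of the (e)-comparison under inner AND recorded geometric automorphisms** (print's «functoriality with respect to
isomorphisms», p. 38 / Rmk. 1.9.5 (i), at one recorded curve): ONE comparison `φ : K_A(Π_X) ≃+* K_{X,NF}` such that (inner) `φ ∘ A.map
(innerIso g) = act i g ∘ φ` for all `g ∈ Π_X`, and (geometric) `φ ∘ A.map α = τ ∘ φ` for every recorded `(α, τ)`.
[cite: MochizukiAbsTopIII2015, Thm 1.9 p.38] -/
def NFPortionAlgorithm.AutEquivariantAt (A : NFPortionAlgorithm.{u}) (M : CurveModel.{u}) (ρ : M.NFGaloisAutAction)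
    (i : ρ.ι) : Prop :=
  ∃ φ : (A.obj (M.ext (ρ.curve i))).functionField ≃+* M.NFFunctionField (ρ.curve i),
    (∀ (g : (M.ext (ρ.curve i)).arith) (x : (A.obj (M.ext (ρ.curve i))).functionField),
      φ ((A.map ((M.ext (ρ.curve i)).innerIso g)).funEquiv x) = ρ.act i g (φ x)) ∧
    ∀ p ∈ ρ.geomAut i, ∀ x : (A.obj (M.ext (ρ.curve i))).functionField,
      φ ((A.map p.1).funEquiv x) = p.2 (φ x)

/-- The aut-clause contains GB-17's inner clause (same curve, the underlying `NFGaloisAction`).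
[cite: MochizukiAbsTopIII2015, Thm 1.9 p.38] -/
theorem NFPortionAlgorithm.AutEquivariantAt.innerEquivariantAt {A : NFPortionAlgorithm.{u}} {M : CurveModel.{u}}
    {ρ : M.NFGaloisAutAction} {i : ρ.ι} (h : A.AutEquivariantAt M ρ i) :
    A.InnerEquivariantAt M ρ.toNFGaloisAction i := by
  obtain ⟨φ, hin, -⟩ := h
  exact ⟨φ, hin⟩

/-- **The body of `Thm_1_9aut'` for a GIVEN algorithm**: the clauses (a)(d)(e) of `Thm_1_9 M` for `A` (VERBATIM `Reconstruction.lean`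
:165–170) AND aut-equivariance at every recorded Thm-1.9 input curve. [cite: MochizukiAbsTopIII2015, Thm 1.9 pp.37-38] -/
def Thm_1_9aut'.WitnessedBy (M : CurveModel.{u}) (ρ : M.NFGaloisAutAction) (A : NFPortionAlgorithm.{u}) : Prop :=
  (∀ X : M.Curve, M.IsThm19Input X →
    (A.obj (M.ext X)).nfPointDecomp =
        {D | ∃ (x : M.Point X) (g : (M.ext X).arith),
          M.IsNFPoint X x ∧ D = MulAut.conj g • M.decomp X x}
      ∧ Nonempty ((A.obj (M.ext X)).constField ≃+* M.kbarNF X)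
      ∧ Nonempty ((A.obj (M.ext X)).functionField ≃+* M.NFFunctionField X))
  ∧ ∀ i : ρ.ι, M.IsThm19Input (ρ.curve i) → A.AutEquivariantAt M ρ i

/-- **[AbsTopIII] Thm. 1.9 WITH its functoriality clause for inner AND recorded geometric automorphisms, comparison form relative to
`(M, ρ)`** — a NEW declaration extending `Thm_1_9'` (which is the instance `geomAut := ∅`-wise); NAMED FACT, instance form ONLY at a named
pair; typed as a hypothesis, neither proved nor refuted here. [cite: MochizukiAbsTopIII2015, Thm 1.9 pp.37-38] -/
def Thm_1_9aut' (M : CurveModel.{u}) (ρ : M.NFGaloisAutAction) : Prop :=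
  ∃ A : NFPortionAlgorithm.{u}, Thm_1_9aut'.WitnessedBy M ρ A

/-- `Thm_1_9aut'.WitnessedBy → Thm_1_9'.WitnessedBy` (forget the geometric pairs). [cite: MochizukiAbsTopIII2015, Thm 1.9 p.38] -/
theorem Thm_1_9aut'.WitnessedBy.toWitnessedBy' {M : CurveModel.{u}} {ρ : M.NFGaloisAutAction} {A : NFPortionAlgorithm.{u}}
    (h : Thm_1_9aut'.WitnessedBy M ρ A) : Thm_1_9'.WitnessedBy M ρ.toNFGaloisAction A :=
  ⟨h.1, fun i hin => (h.2 i hin).innerEquivariantAt⟩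

/-- `Thm_1_9aut' M ρ → Thm_1_9' M ρ.toNFGaloisAction`: the binder of record is implied. [cite: MochizukiAbsTopIII2015, Thm 1.9 p.38] -/
theorem Thm_1_9aut'.toThm_1_9' {M : CurveModel.{u}} {ρ : M.NFGaloisAutAction} (h : Thm_1_9aut' M ρ) :
    Thm_1_9' M ρ.toNFGaloisAction := by
  obtain ⟨A, hA⟩ := h
  exact ⟨A, hA.toWitnessedBy'⟩

/-- `Thm_1_9aut' M ρ → Thm_1_9 M`. [cite: MochizukiAbsTopIII2015, Thm 1.9 p.37] -/
theorem Thm_1_9aut'.toThm_1_9 {M : CurveModel.{u}} {ρ : M.NFGaloisAutAction} (h : Thm_1_9aut' M ρ) : Thm_1_9 M :=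
  h.toThm_1_9'.toThm_1_9

/-- A `Thm_1_9'`-witness IS a `Thm_1_9aut'`-witness when the model records NO geometric automorphism (the conservative-extension check:
the new binder adds nothing where the datum adds nothing). [cite: MochizukiAbsTopIII2015, Thm 1.9 p.38] -/
theorem Thm_1_9'.WitnessedBy.toWitnessedByAut_of_geomAut_eq_empty {M : CurveModel.{u}} {ρ : M.NFGaloisAutAction}
    {A : NFPortionAlgorithm.{u}} (h : Thm_1_9'.WitnessedBy M ρ.toNFGaloisAction A) (hρ : ∀ i, ρ.geomAut i = ∅) :
    Thm_1_9aut'.WitnessedBy M ρ A := by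
  refine ⟨h.1, fun i hin => ?_⟩
  obtain ⟨φ, hφ⟩ := h.2 i hin
  refine ⟨φ, hφ, ?_⟩
  intro p hp
  rw [hρ i] at hp
  exact (Set.notMem_empty p hp).elim

/-! ### Non-transparency beyond the inner clause -/

/-- **NEG (read-off transport along a recorded geometric automorphism)**: an algorithm whose transport along a recorded geometric `α` is
the identity on its function-field output witnesses `AutEquivariantAt` for NO comparison, once the recorded action `τ` moves one element.
[cite: MochizukiAbsTopIII2015, Rmk 1.9.5 (i) p.39] -/
theorem NFPortionAlgorithm.not_autEquivariantAt_of_map_eq_refl {A : NFPortionAlgorithm.{u}} {M : CurveModel.{u}}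
    {ρ : M.NFGaloisAutAction} {i : ρ.ι}
    {p : (M.ext (ρ.curve i) ≅ M.ext (ρ.curve i)) × (M.NFFunctionField (ρ.curve i) ≃+* M.NFFunctionField (ρ.curve i))}
    (hp : p ∈ ρ.geomAut i) (hA : (A.map p.1).funEquiv = RingEquiv.refl _)
    (hmove : ∃ f : M.NFFunctionField (ρ.curve i), p.2 f ≠ f) :
    ¬ A.AutEquivariantAt M ρ i := by
  rintro ⟨φ, -, hφ⟩
  obtain ⟨f, hf⟩ := hmove
  have h := hφ p hp (φ.symm f)
  rw [hA, RingEquiv.refl_apply, RingEquiv.apply_symm_apply] at h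
  exact hf h.symm

/-- **NEG, finer («coefficient-only transport» costume)**: suppose the recorded `τ` moves `t`, but the algorithm's transport `A.map α`
FIXES every element of a subset `S` of its output whose image under the would-be comparison contains `t`.  Then that comparison is not a
witness (for ANY pair `p = (α, τ)`; apply it to a recorded one).  (Use: the elements fixed by all `A.map (innerIso g)` —
«constants-moved-only» algorithms — against a deck transformation moving a transcendental `t`; this is the content `Thm_1_9aut'` adds over
`Thm_1_9'`.) [cite: MochizukiAbsTopIII2015, Rmk 1.9.5 (i) p.39] -/
theorem NFPortionAlgorithm.not_autEquivariant_comparison_of_map_fixes {A : NFPortionAlgorithm.{u}} {M : CurveModel.{u}}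
    {ρ : M.NFGaloisAutAction} {i : ρ.ι}
    {p : (M.ext (ρ.curve i) ≅ M.ext (ρ.curve i)) × (M.NFFunctionField (ρ.curve i) ≃+* M.NFFunctionField (ρ.curve i))}
    (φ : (A.obj (M.ext (ρ.curve i))).functionField ≃+* M.NFFunctionField (ρ.curve i))
    {t : M.NFFunctionField (ρ.curve i)} (ht : p.2 t ≠ t) (hfix : (A.map p.1).funEquiv (φ.symm t) = φ.symm t) :
    ¬ ∀ x : (A.obj (M.ext (ρ.curve i))).functionField, φ ((A.map p.1).funEquiv x) = p.2 (φ x) := by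
  intro hφ
  have h := hφ (φ.symm t)
  rw [hfix, RingEquiv.apply_symm_apply] at h
  exact ht h.symm

/-- **Corollary**: no algorithm that is the identity along a recorded geometric automorphism WITNESSES `Thm_1_9aut'` at a recorded input
curve whose recorded action moves something. [cite: MochizukiAbsTopIII2015, Rmk 1.9.5 (i) p.39] -/
theorem Thm_1_9aut'.not_witnessedBy_of_map_eq_refl {A : NFPortionAlgorithm.{u}} {M : CurveModel.{u}}
    {ρ : M.NFGaloisAutAction} (i : ρ.ι) (hin : M.IsThm19Input (ρ.curve i))
    {p : (M.ext (ρ.curve i) ≅ M.ext (ρ.curve i)) × (M.NFFunctionField (ρ.curve i) ≃+* M.NFFunctionField (ρ.curve i))}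
    (hp : p ∈ ρ.geomAut i) (hA : (A.map p.1).funEquiv = RingEquiv.refl _)
    (hmove : ∃ f : M.NFFunctionField (ρ.curve i), p.2 f ≠ f) :
    ¬ Thm_1_9aut'.WitnessedBy M ρ A := fun h =>
  NFPortionAlgorithm.not_autEquivariantAt_of_map_eq_refl hp hA hmove (h.2 i hin)

/-- GB-17's inner NEG transfers: an inner-trivial algorithm does not witness `Thm_1_9aut'` either, at a recorded input curve whose
inner action moves something. [cite: MochizukiAbsTopIII2015, Rmk 1.9.5 (i) p.39] -/
theorem Thm_1_9aut'.not_witnessedBy_of_isInnerTrivialAt {A : NFPortionAlgorithm.{u}} {M : CurveModel.{u}}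
    {ρ : M.NFGaloisAutAction} (i : ρ.ι) (hin : M.IsThm19Input (ρ.curve i))
    (hA : A.IsInnerTrivialAt (M.ext (ρ.curve i)))
    (hmove : ∃ (g : (M.ext (ρ.curve i)).arith) (f : M.NFFunctionField (ρ.curve i)), ρ.act i g f ≠ f) :
    ¬ Thm_1_9aut'.WitnessedBy M ρ A := fun h =>
  Thm_1_9'.not_witnessedBy_of_isInnerTrivialAt (ρ := ρ.toNFGaloisAction) i hin hA hmove h.toWitnessedBy'

end Literature.AnabelianGeometry.AbsoluteAnabelian.AbsTopIII

end
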